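import Summits.QuantumFields.GaugeBoot.ClassBBootstrapSoundnessZd
import Summits.QuantumFields.GaugeBoot.ClassBStrongCoupling
import HarnessLib

/-!
# The complete Kazakov–Zheng infinite-lattice SDP under DLR uniqueness: Class B is inhabited and the bounds converge to the unique Gibbs value (gauge-boot, L3(α) ↔ L1/L4)

HONEST FRAMING (cell `pub-gaugeboot`, page 1 of every file): the venture produces certified bounds
on lattice expectations at stated coupling, gauge group, dimension and torus size; NOT a mass gap,
NOT a continuum limit, NOT a string tension; NOT Yang–Mills-summit-bearing (barriers
`FixedCouplingUltralocality`, `PerturbativeInvisibility`). Structural; it certifies no number.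

## Content (`SU(N)` on `ℤ^d`, `d ≥ 1`, `β ≥ 0` with a unique DLR state — e.g. `6(d-1)N β < 1`)

`ClassBBootstrapSoundnessZd` proved that every Class-B state is feasible for the COMPLETE KZ SDP
`kzLevelValuesZdSuN` (loop equations, positivity, the full lattice symmetry, site + link + diagonal
RP cuts) at every level, and `RPBootstrapBoundsConvergenceZd` that the bounds of the SDP WITHOUT the
diagonal cuts converge to the extrema over the RP fully symmetric Gibbs states. Whether the complete
SDP is feasible at all at a given `β` is the inhabitation of Class B. Under DLR UNIQUENESS
(`ClassBStrongCoupling.exists_classBState_of_subsingleton`: the unique state is Class B):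

* ★★ `kzLevelValuesZd_nonempty_of_subsingleton` — the complete SDP is feasible at every level, and
  `∫ P dν` (the unique state `ν`) is one of its values;
* ★★★ `tendsto_sSup_kzLevelValuesZd_of_subsingleton` / `tendsto_sInf_…` — its upper and lower
  bounds converge to `∫ P dν` (squeezed between the unique value and the bounds without the diagonal
  cuts, which converge to it); ★★ `…_of_small` — in particular for `6(d-1)N β < 1`;
* ★★ `kz_sandwich_of_subsingleton` — at every level `∫ P dν ∈ kz_n(P) ⊆ rpFullSym_n(P) ⊆ … ⊆
  plain_n(P)`: in the uniqueness window all of Kazakov–Zheng's cuts are sound for THE state and none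
  changes the limit.

What this is NOT: anything outside DLR uniqueness (there Class-B inhabitation is the open
`TorusLimitPointsDiagonalRP`); rates; numbers.

References: V. Kazakov, Z. Zheng, arXiv:2203.11360, arXiv:2404.16925; K. Osterwalder, E. Seiler,
Ann. Phys. 110 (1978) 440, §4 (strong-coupling uniqueness). Folklore.
-/

noncomputable section

open MeasureTheory Filter Topology
open scoped ComplexOrder
open Literature.MathematicalPhysics.QuantumFieldTheory (LatticeRep)
open Literature.MathematicalPhysics.QuantumLattice

namespace Summit.QuantumFields.GaugeBoot

section ZdSuN

variable {d : ℕ} [NeZero d] (N : ℕ)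

/-- ★★ **Under DLR uniqueness (`β ≥ 0`) the complete KZ SDP is feasible at every level**, the unique
state's expectation being one of its values. -/
theorem integral_mem_kzLevelValuesZd_of_subsingleton {β : ℝ} (hβ : 0 ≤ β)
    (hsub : (ymGibbsMeasures (d := d) (fundamentalRep (Fin N)) β).Subsingleton)
    {ν : Measure (LGConfig d (Matrix.specialUnitaryGroup (Fin N) ℂ))}
    (hν : ν ∈ ymGibbsMeasures (d := d) (fundamentalRep (Fin N)) β) (n : ℕ)
    (P : C(LGConfig d (Matrix.specialUnitaryGroup (Fin N) ℂ), ℝ)) :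
    ∫ U, P U ∂ν ∈ kzLevelValuesZdSuN (d := d) N β n P := by
  haveI : SecondCountableTopology (Matrix (Fin N) (Fin N) ℂ) :=
    inferInstanceAs (SecondCountableTopology (Fin N → Fin N → ℂ))
  haveI : SecondCountableTopology (Matrix.specialUnitaryGroup (Fin N) ℂ) :=
    Topology.IsEmbedding.subtypeVal.secondCountableTopology
  obtain ⟨ω, hω, huniq⟩ := exists_classBState_of_subsingleton (fundamentalRep (Fin N))
    (continuous_fundamentalRep _) hβ hsub
  rw [huniq ν hν]
  exact ω.integral_mem_kzLevelValuesZd N β n P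

/-- ★★ Non-emptiness of the complete SDP under uniqueness. -/
theorem kzLevelValuesZd_nonempty_of_subsingleton {β : ℝ} (hβ : 0 ≤ β)
    (hsub : (ymGibbsMeasures (d := d) (fundamentalRep (Fin N)) β).Subsingleton) (n : ℕ)
    (P : C(LGConfig d (Matrix.specialUnitaryGroup (Fin N) ℂ), ℝ)) :
    (kzLevelValuesZdSuN (d := d) N β n P).Nonempty := by
  obtain ⟨ν, hν⟩ := Literature.MathematicalPhysics.QuantumFieldTheory.ymGibbsMeasures_nonempty (d := d)
    (fundamentalRep (Fin N)) (continuous_fundamentalRep _) β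
  exact ⟨_, integral_mem_kzLevelValuesZd_of_subsingleton N hβ hsub hν n P⟩

omit [NeZero d] in
/-- The values with the site and link cuts are plain values: `rpFullSym ⊆ plain`. -/
theorem rpFullSymLevelValuesZd_subset_levelValuesZd (β : ℝ) (n : ℕ)
    (P : C(LGConfig d (Matrix.specialUnitaryGroup (Fin N) ℂ), ℝ)) :
    rpFullSymLevelValuesZdSuN (d := d) N β n P ⊆ levelValuesZdSuN (d := d) N β n P :=
  (rpFullSymLevelValuesZd_subset_fullSym N β n P).trans
    ((fullSymLevelValuesZd_subset_spaceSymLevelValuesZd N β n P).trans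
      ((spaceSymLevelValuesZd_subset_symLevelValuesZd N β n P).trans
        (symLevelValuesZd_subset_levelValuesZd N β n P)))

/-- ★★ **The sandwich at every level under uniqueness**: `∫ P dν ∈ kz_n(P) ⊆ rpFullSym_n(P) ⊆ plain_n(P)`
— all of Kazakov–Zheng's cuts are sound for THE state. -/
theorem kz_sandwich_of_subsingleton {β : ℝ} (hβ : 0 ≤ β)
    (hsub : (ymGibbsMeasures (d := d) (fundamentalRep (Fin N)) β).Subsingleton)
    {ν : Measure (LGConfig d (Matrix.specialUnitaryGroup (Fin N) ℂ))}
    (hν : ν ∈ ymGibbsMeasures (d := d) (fundamentalRep (Fin N)) β) (n : ℕ)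
    (P : C(LGConfig d (Matrix.specialUnitaryGroup (Fin N) ℂ), ℝ)) :
    ∫ U, P U ∂ν ∈ kzLevelValuesZdSuN (d := d) N β n P ∧
      kzLevelValuesZdSuN (d := d) N β n P ⊆ rpFullSymLevelValuesZdSuN (d := d) N β n P ∧
      rpFullSymLevelValuesZdSuN (d := d) N β n P ⊆ levelValuesZdSuN (d := d) N β n P :=
  ⟨integral_mem_kzLevelValuesZd_of_subsingleton N hβ hsub hν n P, kzLevelValuesZd_subset_rpFullSym N β n P,
    rpFullSymLevelValuesZd_subset_levelValuesZd N β n P⟩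

/-- ★★★ **Under DLR uniqueness (`β ≥ 0`) the upper bounds of the complete KZ SDP converge to the
unique Gibbs value `∫ P dν`** (squeeze: `∫ P dν ≤ sup kz_n ≤ sup rpFullSym_n → ∫ P dν`). [folklore] -/
theorem tendsto_sSup_kzLevelValuesZd_of_subsingleton {β : ℝ} (hβ : 0 ≤ β)
    (hsub : (ymGibbsMeasures (d := d) (fundamentalRep (Fin N)) β).Subsingleton)
    {ν : Measure (LGConfig d (Matrix.specialUnitaryGroup (Fin N) ℂ))}
    (hν : ν ∈ ymGibbsMeasures (d := d) (fundamentalRep (Fin N)) β)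
    {P : C(LGConfig d (Matrix.specialUnitaryGroup (Fin N) ℂ), ℝ)}
    (hP : P ∈ polyAlgebra (ι := ZdEdge d) (fundamentalLatticeRep N)) :
    Tendsto (fun n => sSup (kzLevelValuesZdSuN (d := d) N β n P)) atTop (𝓝 (∫ U, P U ∂ν)) := by
  -- the bounds without the diagonal cuts converge to `∫ P dν`
  have hrp : rpDlrValuesSuN (d := d) N β P = {∫ U, P U ∂ν} := by
    obtain ⟨⟨t, μ, hμ, hT, hperm, hrefl, hsite, hlink, rfl⟩, -, -⟩ := rpDlrValues_nonempty_bdd_suN (d := d) N hβ P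
    ext s
    constructor
    · rintro ⟨μ', hμ', -, -, -, -, -, rfl⟩
      rw [hsub hμ' hν]
      rfl
    · rintro rfl
      exact ⟨μ, hμ, hT, hperm, hrefl, hsite, hlink, by rw [hsub hμ hν]⟩
  have hup := tendsto_sSup_rpFullSymLevelValuesZd_suN N hβ hP
  rw [hrp, csSup_singleton] at hup
  -- squeeze
  refine tendsto_of_tendsto_of_tendsto_of_le_of_le' tendsto_const_nhds hup ?_ ?_
  · filter_upwards [eventually_mem_certDomainZd_suN N β hP] with n hn
    obtain ⟨hbdd, -, -⟩ := bdd_rpFullSymLevelValuesZd_suN N hβ hn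
    exact le_csSup (hbdd.mono (kzLevelValuesZd_subset_rpFullSym N β n P))
      (integral_mem_kzLevelValuesZd_of_subsingleton N hβ hsub hν n P)
  · filter_upwards [eventually_mem_certDomainZd_suN N β hP] with n hn
    obtain ⟨hbdd, -, -⟩ := bdd_rpFullSymLevelValuesZd_suN N hβ hn
    exact csSup_le_csSup hbdd (kzLevelValuesZd_nonempty_of_subsingleton N hβ hsub n P)
      (kzLevelValuesZd_subset_rpFullSym N β n P)

/-- ★★★ **… and the lower bounds converge to `∫ P dν`.** -/
theorem tendsto_sInf_kzLevelValuesZd_of_subsingleton {β : ℝ} (hβ : 0 ≤ β)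
    (hsub : (ymGibbsMeasures (d := d) (fundamentalRep (Fin N)) β).Subsingleton)
    {ν : Measure (LGConfig d (Matrix.specialUnitaryGroup (Fin N) ℂ))}
    (hν : ν ∈ ymGibbsMeasures (d := d) (fundamentalRep (Fin N)) β)
    {P : C(LGConfig d (Matrix.specialUnitaryGroup (Fin N) ℂ), ℝ)}
    (hP : P ∈ polyAlgebra (ι := ZdEdge d) (fundamentalLatticeRep N)) :
    Tendsto (fun n => sInf (kzLevelValuesZdSuN (d := d) N β n P)) atTop (𝓝 (∫ U, P U ∂ν)) := by
  have hrp : rpDlrValuesSuN (d := d) N β P = {∫ U, P U ∂ν} := by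
    obtain ⟨⟨t, μ, hμ, hT, hperm, hrefl, hsite, hlink, rfl⟩, -, -⟩ := rpDlrValues_nonempty_bdd_suN (d := d) N hβ P
    ext s
    constructor
    · rintro ⟨μ', hμ', -, -, -, -, -, rfl⟩
      rw [hsub hμ' hν]
      rfl
    · rintro rfl
      exact ⟨μ, hμ, hT, hperm, hrefl, hsite, hlink, by rw [hsub hμ hν]⟩
  have hlow := tendsto_sInf_rpFullSymLevelValuesZd_suN N hβ hP
  rw [hrp, csInf_singleton] at hlow
  refine tendsto_of_tendsto_of_tendsto_of_le_of_le' hlow tendsto_const_nhds ?_ ?_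
  · filter_upwards [eventually_mem_certDomainZd_suN N β hP] with n hn
    obtain ⟨-, hbdd, -⟩ := bdd_rpFullSymLevelValuesZd_suN N hβ hn
    exact csInf_le_csInf hbdd (kzLevelValuesZd_nonempty_of_subsingleton N hβ hsub n P)
      (kzLevelValuesZd_subset_rpFullSym N β n P)
  · filter_upwards [eventually_mem_certDomainZd_suN N β hP] with n hn
    obtain ⟨-, hbdd, -⟩ := bdd_rpFullSymLevelValuesZd_suN N hβ hn
    exact csInf_le (hbdd.mono (kzLevelValuesZd_subset_rpFullSym N β n P))
      (integral_mem_kzLevelValuesZd_of_subsingleton N hβ hsub hν n P)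

/-- ★★ **Strong coupling `0 ≤ β`, `6(d-1)N β < 1`: the complete KZ SDP bounds converge to the unique
Gibbs value.** [folklore] -/
theorem tendsto_kzLevelValuesZd_of_small {β : ℝ} (hβ : 0 ≤ β) (hsmall : 6 * ((d - 1 : ℕ) : ℝ) * N * |β| < 1)
    {ν : Measure (LGConfig d (Matrix.specialUnitaryGroup (Fin N) ℂ))}
    (hν : ν ∈ ymGibbsMeasures (d := d) (fundamentalRep (Fin N)) β)
    {P : C(LGConfig d (Matrix.specialUnitaryGroup (Fin N) ℂ), ℝ)}
    (hP : P ∈ polyAlgebra (ι := ZdEdge d) (fundamentalLatticeRep N)) :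
    Tendsto (fun n => sSup (kzLevelValuesZdSuN (d := d) N β n P)) atTop (𝓝 (∫ U, P U ∂ν)) ∧
      Tendsto (fun n => sInf (kzLevelValuesZdSuN (d := d) N β n P)) atTop (𝓝 (∫ U, P U ∂ν)) :=
  have hsub := subsingleton_ymGibbsMeasures_allGroups (fundamentalRep (Fin N)) (continuous_fundamentalRep _) hsmall
  ⟨tendsto_sSup_kzLevelValuesZd_of_subsingleton N hβ hsub hν hP,
    tendsto_sInf_kzLevelValuesZd_of_subsingleton N hβ hsub hν hP⟩

end ZdSuN

end Summit.QuantumFields.GaugeBoot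

end
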